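import Mathlib
import Summits.KontsevichZagierPeriods.Zeta5Search.WedgeDictionaryTerminalDescent
import HarnessLib

/-!
# ζ(5) search — Elimination: the K₈ CLOSURE of the three-term relation module (STAR and PENCIL are the
# edges of a complete graph on eight node potentials; any spanning tree generates all 28 families)

HONEST FRAMING: systematic search; no irrationality claim unless certified.  Cell `pub-zeta5`, family-designer
class `elim` (linear algebra of relation modules), fam-elim gen 28 (2026-08-21).  Pure algebra: ring identities between
the coefficient polynomials of `WedgeDictionaryThreeTerm` and their formal consequences for ANY function on the
parameter lattice; no conjecture node is used or discharged; nothing about `ζ(5)`; no number of record moves.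

WHAT.  gen-1's two relation families at a dual point `P = b(a)` (`WedgeDictionaryThreeTerm` §4),
  STAR(i,k):  `κ_{ik}(P)·F(a) − χ_kΠ_k(P)·F(a − s_k) + χ_iΠ_i(P)·F(a − s_i) = 0`,
  PENCIL(c,i): `−(c₂+1)(c₃+1)·F(c) + (c_i+1)(c₀+2−c_i)·F(c + DS) + χ_iΠ_i(DS c)·F(c + DS − s_i) = 0`,
have the structure of a POTENTIAL DIFFERENCE.  With the slot weight `ψ_s(P) = P_s(P₀+1−P_s)` (`slotWeight`):
* `κ_{ik}(P) = ψ_i(P) − ψ_k(P)` (`starKappa_eq_sub`), `(c_i+1)(c₀+2−c_i) = ψ_i(b(c + DS))` (`pencilApex_eq_slotWeight`),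
  `−(c₂+1)(c₃+1) = −b₂(c+DS)·b₃(c+DS)` (`pencilBase_eq`);
* hence for ANY commutative ring `R`, any `F : (Fin 8 → ℤ) → R` and any "arm" `A : (Fin 8 → ℤ) → ℕ → R` (for the cellular and
  dictionary families `A a s = χ_sΠ_s(P)·F(a − s_s)`), with the NODE POTENTIAL `N_s(a) = ψ_s(P)·F(a) + A a s` (`node`):
  `STAR(i,k)(a) ⟺ N_i(a) = N_k(a)` (`starG_iff`) and `PENCIL(c,i) ⟺ N_i(c + DS) = −B(c)` (`pencilG_iff`, base term `B`).
So at an apex `a = c + DS` the 21 STAR and 7 PENCIL relations are the 28 EDGES OF THE COMPLETE GRAPH `K₈` on the eight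
values `{−B(c), N_1(a), …, N_7(a)}`: every spanning tree generates the module pointwise (`starG_symm`, `starG_trans`,
`starG_of_pencilG`, `pencilG_of_pencilG_starG`, `starG_all_of_hub`, `pencilG_all_of_one`, `starPencil_iff_nodes`).

CONSEQUENCES FOR THE CELLULAR NODES (`CellStar`, `CellPencil`, still `@[conjecture]`; nothing here proves an instance):
on the INTERIOR (all slots `≥ 1`, where `a − s_m` and `a − DS` stay in the region: `regionHyp_slotDown`,
`regionHyp_sub_dsUp`) the seven PENCIL slots generate all 21 STAR pairs (`cellStarInt_of_cellPencil`), one PENCIL slot and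
the STARs through it generate all PENCIL slots (`cellPencil_of_slot_of_starInt`, `cellPencil_of_slot_of_cellStar`), and STAR
is transitive in the pair (`cellStarInt_trans`).  CAVEAT (exact census, fam-elim g28 `CLOSURE-CENSUS.md`): gen-1's descent D2
(`Elimination.explicitPQ_of_provider`) consumes STAR only at NON-INTERIOR points (a zero slot), where lowering a zero slot
leaves the region and no transitivity through it is available; there every one of the 21 pairs is needed (points with two
non-zero slots), so this file thins `CellPencil` (to one slot, given `CellStar`) but not `CellStar`.
USE (cert-2's D-exact plan `HOME/cert-2/g7/DEXACT-PLAN.md` (P2)–(P4)): a torus Stokes certificate is needed for a SPANNING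
TREE only (e.g. the eleven STAR pairs and five PENCIL slots found feasible there already generate all 28 families at interior
exponents); `Families.Cellular.dualConstantTerm_star35'` is `StarG F A a 3 5` with `F = dualConstantTerm`,
`A a s = −χ_sΠ_s(b a)·F(a − s_s)` (`starG_negArm_iff`).
-/

open Finset

namespace Summit.KontsevichZagierPeriods.Zeta5Search.Elimination

open Summit.KontsevichZagierPeriods.Zeta5Search.WedgeDictionary
open Literature.NumberTheory.Irrationality.BrownZudilin2022 (bOfA cellularIntegral)

/-! ## 1. The slot weight and the three coefficient identities -/

/-- The slot weight `ψ_s(P) = P_s · (P₀ + 1 − P_s)`. -/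
def slotWeight (P : ℕ → ℤ) (s : ℕ) : ℤ := P s * (P 0 + 1 - P s)

/-- `κ_{ik}(P) = ψ_i(P) − ψ_k(P)`. -/
theorem starKappa_eq_sub (P : ℕ → ℤ) (i k : ℕ) : starKappa P i k = slotWeight P i - slotWeight P k := by
  unfold starKappa slotWeight; ring

/-- The PENCIL apex coefficient is the slot weight at the apex: `(c_i+1)(c₀+2−c_i) = ψ_i(b(c + DS))`. -/
theorem pencilApex_eq_slotWeight (c : Fin 8 → ℤ) {i : ℕ} (hi : i ∈ Icc 1 7) :
    pencilApex (bOfA c) i = slotWeight (bOfA (c + dsUp)) i := by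
  have hi7 : i ≤ 7 := (mem_Icc.1 hi).2
  have hi0 : i ≠ 0 := by have := (mem_Icc.1 hi).1; omega
  unfold pencilApex slotWeight
  rw [bOfA_add_dsUp c i hi7, bOfA_add_dsUp c 0 (by norm_num), if_neg hi0, if_pos rfl]
  ring

/-- The PENCIL base coefficient in apex coordinates: `−(c₂+1)(c₃+1) = −b₂(c + DS)·b₃(c + DS)`. -/
theorem pencilBase_eq (c : Fin 8 → ℤ) : pencilBase (bOfA c) = -(bOfA (c + dsUp) 2 * bOfA (c + dsUp) 3) := by
  unfold pencilBase
  rw [bOfA_add_dsUp c 2 (by norm_num), bOfA_add_dsUp c 3 (by norm_num), if_neg (by decide), if_neg (by decide)]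

/-! ## 2. Node potentials: STAR and PENCIL for an arbitrary function -/

section Generic

variable {R : Type*} [CommRing R]

/-- The node potential `N_s(a) = ψ_s(b(a))·F(a) + A a s` of slot `s` at `a`. -/
def node (F : (Fin 8 → ℤ) → R) (A : (Fin 8 → ℤ) → ℕ → R) (a : Fin 8 → ℤ) (s : ℕ) : R :=
  (slotWeight (bOfA a) s : R) * F a + A a s

/-- The generic STAR(i,k) relation at `a`: `κ_{ik}(b(a))·F(a) − A a k + A a i = 0` (a predicate in `F, A, a, i, k`,
not a statement). -/
def StarG (F : (Fin 8 → ℤ) → R) (A : (Fin 8 → ℤ) → ℕ → R) (a : Fin 8 → ℤ) (i k : ℕ) : Prop :=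
  (starKappa (bOfA a) i k : R) * F a - A a k + A a i = 0

/-- The generic PENCIL(c,i) relation: `B c + (c_i+1)(c₀+2−c_i)·F(c + DS) + A (c + DS) i = 0` (a predicate, not a
statement). -/
def PencilG (F : (Fin 8 → ℤ) → R) (A : (Fin 8 → ℤ) → ℕ → R) (B : (Fin 8 → ℤ) → R) (c : Fin 8 → ℤ) (i : ℕ) : Prop :=
  B c + (pencilApex (bOfA c) i : R) * F (c + dsUp) + A (c + dsUp) i = 0

variable {F : (Fin 8 → ℤ) → R} {A : (Fin 8 → ℤ) → ℕ → R} {B : (Fin 8 → ℤ) → R}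

/-- **STAR is a potential difference**: `STAR(i,k)(a) ⟺ N_i(a) = N_k(a)`. -/
theorem starG_iff {a : Fin 8 → ℤ} {i k : ℕ} : StarG F A a i k ↔ node F A a i = node F A a k := by
  unfold StarG node
  rw [starKappa_eq_sub]
  push_cast
  constructor
  · intro h; linear_combination h
  · intro h; linear_combination h

/-- **PENCIL is a potential difference**: `PENCIL(c,i) ⟺ N_i(c + DS) = −B(c)`. -/
theorem pencilG_iff {c : Fin 8 → ℤ} {i : ℕ} (hi : i ∈ Icc 1 7) : PencilG F A B c i ↔ node F A (c + dsUp) i = -B c := by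
  unfold PencilG node
  rw [pencilApex_eq_slotWeight c hi]
  constructor
  · intro h; linear_combination h
  · intro h; linear_combination h

/-- STAR is antisymmetric in the pair. -/
theorem starG_symm {a : Fin 8 → ℤ} {i k : ℕ} (h : StarG F A a i k) : StarG F A a k i :=
  starG_iff.2 (starG_iff.1 h).symm

/-- **STAR is transitive in the pair** (same point `a`). -/
theorem starG_trans {a : Fin 8 → ℤ} {i j k : ℕ} (h₁ : StarG F A a i j) (h₂ : StarG F A a j k) : StarG F A a i k :=
  starG_iff.2 ((starG_iff.1 h₁).trans (starG_iff.1 h₂))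

/-- Two PENCILs with the same base give the STAR of their slots at the apex. -/
theorem starG_of_pencilG {c : Fin 8 → ℤ} {i k : ℕ} (hi : i ∈ Icc 1 7) (hk : k ∈ Icc 1 7) (h₁ : PencilG F A B c i)
    (h₂ : PencilG F A B c k) : StarG F A (c + dsUp) i k :=
  starG_iff.2 (((pencilG_iff hi).1 h₁).trans ((pencilG_iff hk).1 h₂).symm)

/-- A PENCIL and a STAR through its slot at the apex give the PENCIL of the other slot. -/
theorem pencilG_of_pencilG_starG {c : Fin 8 → ℤ} {i k : ℕ} (hi : i ∈ Icc 1 7) (hk : k ∈ Icc 1 7)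
    (h₁ : PencilG F A B c i) (h₂ : StarG F A (c + dsUp) i k) : PencilG F A B c k :=
  (pencilG_iff hk).2 ((starG_iff.1 h₂).symm.trans ((pencilG_iff hi).1 h₁))

/-- **Hub spanning tree**: the STARs through one slot `s₀` give every STAR at the point. -/
theorem starG_all_of_hub {a : Fin 8 → ℤ} (s₀ : ℕ) (h : ∀ k ∈ Icc 1 7, k ≠ s₀ → StarG F A a s₀ k) {i k : ℕ}
    (hi : i ∈ Icc 1 7) (hk : k ∈ Icc 1 7) : StarG F A a i k := by
  by_cases his : i = s₀
  · subst his
    by_cases hki : k = i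
    · subst hki; exact starG_iff.2 rfl
    · exact h k hk hki
  · by_cases hks : k = s₀
    · subst hks; exact starG_symm (h i hi his)
    · exact starG_trans (starG_symm (h i hi his)) (h k hk hks)

/-- **One PENCIL suffices given the STARs through its slot** at the apex. -/
theorem pencilG_all_of_one {c : Fin 8 → ℤ} {s₀ : ℕ} (hs₀ : s₀ ∈ Icc 1 7) (h₀ : PencilG F A B c s₀)
    (h : ∀ k ∈ Icc 1 7, k ≠ s₀ → StarG F A (c + dsUp) s₀ k) {k : ℕ} (hk : k ∈ Icc 1 7) : PencilG F A B c k := by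
  by_cases hks : k = s₀
  · subst hks; exact h₀
  · exact pencilG_of_pencilG_starG hs₀ hk h₀ (h k hk hks)

/-- **The 28 relations at an apex are `N_1 = ⋯ = N_7 = −B`**: all STARs at `c + DS` and all PENCILs with base `c` hold
iff every node potential at the apex equals `−B(c)`. -/
theorem starPencil_iff_nodes {c : Fin 8 → ℤ} :
    ((∀ i ∈ Icc 1 7, ∀ k ∈ Icc 1 7, StarG F A (c + dsUp) i k) ∧ ∀ i ∈ Icc 1 7, PencilG F A B c i) ↔
      ∀ s ∈ Icc 1 7, node F A (c + dsUp) s = -B c := by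
  constructor
  · rintro ⟨-, hP⟩ s hs
    exact (pencilG_iff hs).1 (hP s hs)
  · intro h
    refine ⟨fun i hi k hk => starG_iff.2 ((h i hi).trans (h k hk).symm), fun i hi => (pencilG_iff hi).2 (h i hi)⟩

/-- The arm of gen-1's families: `A a s = χ_sΠ_s(b(a))·F(a − s_s)`. -/
def fanArm (F : (Fin 8 → ℤ) → R) (a : Fin 8 → ℤ) (s : ℕ) : R := (fanCoeff (bOfA a) s : R) * F (a + slotDown s)

/-- The base term of gen-1's PENCIL: `B c = −(c₂+1)(c₃+1)·F(c)`. -/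
def pencilBaseTerm (F : (Fin 8 → ℤ) → R) (c : Fin 8 → ℤ) : R := (pencilBase (bOfA c) : R) * F c

/-- With gen-1's arm, `StarG` is literally `κ·F(a) − χ_kΠ_k·F(a − s_k) + χ_iΠ_i·F(a − s_i) = 0`. -/
theorem starG_fanArm_iff {a : Fin 8 → ℤ} {i k : ℕ} :
    StarG F (fanArm F) a i k ↔ (starKappa (bOfA a) i k : R) * F a
      - (fanCoeff (bOfA a) k : R) * F (a + slotDown k) + (fanCoeff (bOfA a) i : R) * F (a + slotDown i) = 0 :=
  Iff.rfl

/-- With gen-1's arm and base, `PencilG` is literally gen-1's PENCIL(c,i) for `F`. -/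
theorem pencilG_fanArm_iff {c : Fin 8 → ℤ} {i : ℕ} :
    PencilG F (fanArm F) (pencilBaseTerm F) c i ↔ (pencilBase (bOfA c) : R) * F c
      + (pencilApex (bOfA c) i : R) * F (c + dsUp) + (fanCoeff (bOfA (c + dsUp)) i : R) * F (c + dsUp + slotDown i) = 0 :=
  Iff.rfl

/-- With the OPPOSITE arm `A a s = −χ_sΠ_s·F(a − s_s)` (the unsigned dual constant term of cert-2's
`Families.DualConstantTermStar35`), `StarG` is `κ·F(a) + χ_kΠ_k·F(a − s_k) − χ_iΠ_i·F(a − s_i) = 0`. -/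
theorem starG_negArm_iff {a : Fin 8 → ℤ} {i k : ℕ} :
    StarG F (fun a s => -fanArm F a s) a i k ↔ (starKappa (bOfA a) i k : R) * F a
      + (fanCoeff (bOfA a) k : R) * F (a + slotDown k) - (fanCoeff (bOfA a) i : R) * F (a + slotDown i) = 0 := by
  unfold StarG fanArm
  constructor
  · intro h; linear_combination h
  · intro h; linear_combination h

end Generic

/-! ## 3. The cellular families as node identities; closure on the interior -/

/-- gen-1's cellular STAR relation at `(a; i, k)` is `StarG cellularIntegral (fanArm cellularIntegral) a i k`. -/
theorem threeTermRel_star_iff {a : Fin 8 → ℤ} {i k : ℕ} :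
    ThreeTermRel (starKappa (bOfA a) i k) (-fanCoeff (bOfA a) k) (fanCoeff (bOfA a) i) a (a + slotDown k)
        (a + slotDown i) ↔ StarG cellularIntegral (fanArm cellularIntegral) a i k := by
  unfold ThreeTermRel StarG fanArm
  push_cast
  constructor
  · intro h; linear_combination h
  · intro h; linear_combination h

/-- gen-1's cellular PENCIL relation at `(c; i)` is `PencilG cellularIntegral (fanArm _) (pencilBaseTerm _) c i`. -/
theorem threeTermRel_pencil_iff {c : Fin 8 → ℤ} {i : ℕ} :
    ThreeTermRel (pencilBase (bOfA c)) (pencilApex (bOfA c) i) (fanCoeff (bOfA (c + dsUp)) i) c (c + dsUp)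
        (c + dsUp + slotDown i) ↔ PencilG cellularIntegral (fanArm cellularIntegral) (pencilBaseTerm cellularIntegral) c i := by
  unfold ThreeTermRel PencilG fanArm pencilBaseTerm
  push_cast
  exact Iff.rfl

/-- `CellStar` restricted to one pair of slots `(i, k)` (a predicate in the pair; for `i ≠ k` in `{1,…,7}` an instance of
the conjecture node `CellStar`, NOT proved here). -/
def CellStarPair (i k : ℕ) : Prop :=
  ∀ (a : Fin 8 → ℤ) (j₀ j₁ j₂ : ℕ), RegionHyp a j₀ → RegionHyp (a + slotDown k) j₁ → RegionHyp (a + slotDown i) j₂ →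
    ThreeTermRel (starKappa (bOfA a) i k) (-fanCoeff (bOfA a) k) (fanCoeff (bOfA a) i) a (a + slotDown k) (a + slotDown i)

/-- `CellPencil` restricted to one slot `i` (a predicate in the slot; for `i ∈ {1,…,7}` an instance of the conjecture node
`CellPencil`, NOT proved here). -/
def CellPencilSlot (i : ℕ) : Prop :=
  ∀ (a : Fin 8 → ℤ) (j₀ j₁ j₂ : ℕ), RegionHyp a j₀ → RegionHyp (a + dsUp) j₁ → RegionHyp (a + dsUp + slotDown i) j₂ →
    ThreeTermRel (pencilBase (bOfA a)) (pencilApex (bOfA a) i) (fanCoeff (bOfA (a + dsUp)) i) a (a + dsUp)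
      (a + dsUp + slotDown i)

/-- STAR for the pair `(i, k)` at INTERIOR region points (all slots `≥ 1`; the two lowered points are then region points);
a predicate in the pair, implied by `CellStarPair i k` (`cellStarInt_of_pair`), NOT proved here. -/
def CellStarInt (i k : ℕ) : Prop :=
  ∀ (a : Fin 8 → ℤ) (j : ℕ), RegionHyp a j → (∀ m ∈ Icc 1 7, 1 ≤ bOfA a m) →
    StarG cellularIntegral (fanArm cellularIntegral) a i k

/-- `CellStar` is the conjunction of its 21 pair families (both orders). -/
theorem cellStar_iff_pairs : CellStar ↔ ∀ i ∈ Icc 1 7, ∀ k ∈ Icc 1 7, i ≠ k → CellStarPair i k :=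
  ⟨fun h i hi k hk hik a j₀ j₁ j₂ => h a i k j₀ j₁ j₂ hi hk hik,
    fun h a i k j₀ j₁ j₂ hi hk hik => h i hi k hk hik a j₀ j₁ j₂⟩

/-- `CellPencil` is the conjunction of its 7 slot families. -/
theorem cellPencil_iff_slots : CellPencil ↔ ∀ i ∈ Icc 1 7, CellPencilSlot i :=
  ⟨fun h i hi a j₀ j₁ j₂ => h a i j₀ j₁ j₂ hi, fun h a i j₀ j₁ j₂ hi => h i hi a j₀ j₁ j₂⟩

/-- A pair family gives the interior STAR of that pair. -/
theorem cellStarInt_of_pair {i k : ℕ} (hi : i ∈ Icc 1 7) (hk : k ∈ Icc 1 7) (h : CellStarPair i k) : CellStarInt i k := by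
  intro a j hr hpos
  exact threeTermRel_star_iff.1
    (h a j j j hr (regionHyp_slotDown hr hk (hpos k hk)) (regionHyp_slotDown hr hi (hpos i hi)))

/-- Interior STAR is symmetric in the pair. -/
theorem cellStarInt_symm {i k : ℕ} (h : CellStarInt i k) : CellStarInt k i :=
  fun a j hr hpos => starG_symm (h a j hr hpos)

/-- **Interior STAR is transitive in the pair.** -/
theorem cellStarInt_trans {i j k : ℕ} (h₁ : CellStarInt i j) (h₂ : CellStarInt j k) : CellStarInt i k :=
  fun a j' hr hpos => starG_trans (h₁ a j' hr hpos) (h₂ a j' hr hpos)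

/-- **Two PENCIL slots give the interior STAR of their pair** (base `a − DS`, a region point by `regionHyp_sub_dsUp`). -/
theorem cellStarInt_of_pencilSlots {i k : ℕ} (hi : i ∈ Icc 1 7) (hk : k ∈ Icc 1 7) (h₁ : CellPencilSlot i)
    (h₂ : CellPencilSlot k) : CellStarInt i k := by
  intro a j hr hpos
  have hb : RegionHyp (a - dsUp) j := regionHyp_sub_dsUp hr hpos
  have hca : a - dsUp + dsUp = a := sub_add_cancel a dsUp
  have hP₁ := h₁ (a - dsUp) j j j hb (by rw [hca]; exact hr) (by rw [hca]; exact regionHyp_slotDown hr hi (hpos i hi))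
  have hP₂ := h₂ (a - dsUp) j j j hb (by rw [hca]; exact hr) (by rw [hca]; exact regionHyp_slotDown hr hk (hpos k hk))
  have hS := starG_of_pencilG hi hk (threeTermRel_pencil_iff.1 hP₁) (threeTermRel_pencil_iff.1 hP₂)
  rwa [hca] at hS

/-- **The seven PENCIL slots generate all 21 STAR pairs on the interior.** -/
theorem cellStarInt_of_cellPencil (h : CellPencil) {i k : ℕ} (hi : i ∈ Icc 1 7) (hk : k ∈ Icc 1 7) : CellStarInt i k :=
  cellStarInt_of_pencilSlots hi hk ((cellPencil_iff_slots.1 h) i hi) ((cellPencil_iff_slots.1 h) k hk)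

/-- **One PENCIL slot and the interior STARs through it give another PENCIL slot.** -/
theorem cellPencilSlot_of_slot_of_starInt {i k : ℕ} (hi : i ∈ Icc 1 7) (hk : k ∈ Icc 1 7) (h₁ : CellPencilSlot i)
    (h₂ : CellStarInt i k) : CellPencilSlot k := by
  intro c j₀ j₁ j₂ hr₀ hr₁ _hr₂
  -- at a PENCIL apex every slot is `≥ 1` (E-L26e's `slots_pos_dsUp`, re-derived to keep this file's imports light)
  have hpos : ∀ m ∈ Icc 1 7, 1 ≤ bOfA (c + dsUp) m := by
    intro m hm
    have hm7 : m ≤ 7 := (mem_Icc.1 hm).2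
    have hm0 : m ≠ 0 := by have := (mem_Icc.1 hm).1; omega
    rw [bOfA_add_dsUp c m hm7, if_neg hm0]
    have := (hr₀.2.2.1 m hm).1
    omega
  have hP := threeTermRel_pencil_iff.1 (h₁ c j₀ j₁ j₁ hr₀ hr₁ (regionHyp_slotDown hr₁ hi (hpos i hi)))
  exact threeTermRel_pencil_iff.2 (pencilG_of_pencilG_starG hi hk hP (h₂ (c + dsUp) j₁ hr₁ hpos))

/-- **`CellPencil` from ONE slot and the interior STARs through it.** -/
theorem cellPencil_of_slot_of_starInt {s₀ : ℕ} (hs₀ : s₀ ∈ Icc 1 7) (h₀ : CellPencilSlot s₀)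
    (h : ∀ k ∈ Icc 1 7, k ≠ s₀ → CellStarInt s₀ k) : CellPencil := by
  rw [cellPencil_iff_slots]
  intro k hk
  by_cases hks : k = s₀
  · subst hks; exact h₀
  · exact cellPencilSlot_of_slot_of_starInt hs₀ hk h₀ (h k hk hks)

/-- **`CellPencil` from ONE slot and `CellStar`** (so `Elimination.explicitPQ_of_cells` needs PENCIL at one slot only). -/
theorem cellPencil_of_slot_of_cellStar {s₀ : ℕ} (hs₀ : s₀ ∈ Icc 1 7) (h₀ : CellPencilSlot s₀) (hS : CellStar) :
    CellPencil :=
  cellPencil_of_slot_of_starInt hs₀ h₀ fun k hk hks =>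
    cellStarInt_of_pair hs₀ hk ((cellStar_iff_pairs.1 hS) s₀ hs₀ k hk (Ne.symm hks))

/-- **Interior STAR from a hub**: the pair families through one slot `s₀` give every interior STAR. -/
theorem cellStarInt_of_hub (s₀ : ℕ) (h : ∀ k ∈ Icc 1 7, k ≠ s₀ → CellStarInt s₀ k) {i k : ℕ} (hi : i ∈ Icc 1 7)
    (hk : k ∈ Icc 1 7) : CellStarInt i k :=
  fun a j hr hpos => starG_all_of_hub s₀ (fun m hm hms => h m hm hms a j hr hpos) hi hk

end Summit.KontsevichZagierPeriods.Zeta5Search.Elimination
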